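import Literature.AnabelianGeometry.SemiGraphs.BTempQDPairHomHat
import Literature.AnabelianGeometry.SemiGraphs.BTempQDPairZeroProper
import HarnessLib

/-!
# Semi-graphs of anabelioids, Appendix, proof of Theorem A.4: the PULLBACK OF A 1-PROPER COVER
# along a morphism of QD-pairs of `B^temp(Π)` (towards the composition law on `Hom^`)

Mochizuki, *Semi-graphs of anabelioids*, Publ. RIMS **42** (2006) 221–322, Appendix, proof of
Theorem A.4, manuscript p. 84 (PRIMS p. 314 ll. 5–8) [cite: MochizukiSemiAnbd2006, Thm A.4 proof p.84]:
"Moreover, one verifies immediately that this reconstruction [of `Hom_{T_i}(B/Γ_B, C/Γ_C)` as the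
filtered inductive limit `Hom^((B, Γ_B), (C, Γ_C)) = lim_→ Hom̄((B′, Γ_B′), (C, Γ_C))` over 1-proper
morphisms `(B′, Γ_B′) → (B, Γ_B)`] is compatible with composition of arrows".  To compose two
elements `[(B′ → B, f̄)]`, `[(C′ → C, ḡ)]` one needs a 1-proper cover of `(B′, Γ_B′)` mapping to
`(C′, Γ_C′)` compatibly with `f` — the pullback of the cover `C′ → C` along `f : B′ → C`.

Row **A4-lim-comp** of the abc-iut cell's `plan/L3/SUBDAG-SemiAnbd-Cor311.md` (holder
abc-iut-w5-d129; this file by wave-5 seat abc-iut-w5-d220), PART 1 = the construction, for QD-pairs of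
the model temperoid `B^temp(Π)` (`Π` any topological group), on points, over abc-iut-w5-d129's explicit
fibre products / orbit sub-objects (`BTempPullbackOrbit.lean`) and 1-proper covers
(`BTempQDPairHomHat.lean`):

* `QDPair.OneProperCover.pullbackAlong d f hQ : OneProperCover Q` — for a 1-proper cover
  `d : (C′, Γ_C′) → (C, Γ_C)`, a morphism of QD-pairs `f : (Q, Γ_Q) → (C, Γ_C)` and `Q` connected: its
  source is the `Π`-orbit `B″` of a point `(q₀, c′₀)` (`f q₀ = d c′₀`) of `Q ×_{C/Γ_C} C′` (the fibre
  product is taken over `C/Γ_C`, so that EVERY pair `(γ_Q, γ′) ∈ Γ_Q × Γ_C′` acts on it — the device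
  of abc-iut-w4-d081's `BTempQDPairCoversDirectedCover.lean`), with the group `Γ_B″` of automorphisms
  acting as such a pair on the two coordinates, and its arrow is the first projection;
  1-PROPERNESS: 0-proper since `Q` is connected (`QDPair.isZeroProper_of_isStronglyConnected`); LIFT —
  `γ_Q` lies over some `γ_C ∈ Γ_C` (`f` is a morphism of QD-pairs), `γ_C` lifts to `γ′ ∈ Γ_C′` (`d` is
  1-proper), and after writing `γ_Q q₀ = a·q₀` the points `γ′ c′₀`, `a·c′₀` lie in one fibre of
  `C′ → C`, so a correction `k ∈ Ker(Γ_C′ → Γ_C)` makes `(γ_Q, kγ′)` map `(q₀, c′₀)` to `a·(q₀, c′₀)`;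
  QUOTIENT — two points `a·z₀`, `a′·z₀` over one point of `Q` differ by `(1, k)` with `k` in that
  kernel (`QDPair.isQuotient_iff_surjective`);
* `QDPair.OneProperCover.pullbackAlongSnd d f hQ : (pullbackAlong d f hQ).src ⟶ d.src` (second
  projection) and the commutative square `pullbackAlongSnd ≫ d.hom = (pullbackAlong d f hQ).hom ≫ f`
  (`pullbackAlong_w`; it commutes on the chosen orbit because it does at `(q₀, c′₀)`).

Part 2 (`BTempQDPairHomHatComp.lean`) composes classes of `Hom^` with this cover and proves the
compatibility with `q`.  Elementary `Π`-set theory; nothing refers to the IUT corpus and no side is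
taken on any disputed claim.
-/

open CategoryTheory CategoryTheory.Limits

namespace Literature.AnabelianGeometry.SemiGraphs

open Literature.AlgebraicGeometry.Frobenioids (IsConnectedObj IsNonemptyObj)
open Literature.AlgebraicGeometry.Frobenioids.QuasiTemperoid.BTempConnected (hom_ρ hom_ext_apply
  ρ_one_apply ρ_mul_apply ρ_inv_apply nonempty_of_isConnectedObj exists_ρ_eq_of_isConnectedObj
  hom_eq_of_apply_eq)

universe u

namespace QDPair

namespace OneProperCover

open BTemp

variable {G : Type u} [Group G] [TopologicalSpace G] [IsTopologicalGroup G]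
variable {Q C : QDPair (BTemp G)} (d : OneProperCover C) (f : Q ⟶ C) (hQ : Q.IsStronglyConnected)

/-! ### Generalities on automorphisms and 1-proper covers, on points -/

omit [IsTopologicalGroup G] in
/-- `γ⁻¹ (γ x) = x` on points, for an automorphism of an object of `B^temp(Π)`. [folklore] -/
private theorem aut_inv_apply_aut {X : BTemp G} (γ : Aut X) (x : X.obj.V) :
    ((γ⁻¹).hom.hom.hom (γ.hom.hom.hom x) : X.obj.V) = x := by
  change ((γ.hom ≫ γ.inv).hom.hom x : X.obj.V) = x
  rw [γ.hom_inv_id]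
  rfl

/-- The arrow of a 1-proper cover is surjective on points (its quotient clause).
[cite: MochizukiSemiAnbd2006, Def A.3(iv) p.82] -/
theorem surjective_hom (d : OneProperCover C) :
    Function.Surjective fun x : d.src.A.obj.V => (d.hom.hom.hom.hom x : C.A.obj.V) :=
  IsQuotient.surjective (P := (⟨d.src.A, Hom.stabilizer d.hom⟩ : QDPair (BTemp G))) d.isOneProper.2.2

/-- Two points of `C′` over one point of `C` differ by an element of `Ker(Γ_C′ → Γ_C)` (the quotient
clause of 1-properness, on points). [cite: MochizukiSemiAnbd2006, Def A.3(iv) p.82] -/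
theorem exists_stabilizer_apply_eq_of_hom_eq (d : OneProperCover C) {x y : d.src.A.obj.V}
    (h : (d.hom.hom.hom.hom x : C.A.obj.V) = d.hom.hom.hom.hom y) :
    ∃ k ∈ Hom.stabilizer d.hom, (k.hom.hom.hom x : d.src.A.obj.V) = y :=
  (IsQuotient.apply_eq_iff (P := (⟨d.src.A, Hom.stabilizer d.hom⟩ : QDPair (BTemp G)))
    d.isOneProper.2.2).mp h

/-! ### The ambient fibre product `Q ×_{C/Γ_C} C′`, the base point and the orbit -/

/-- `Q ×_{C/Γ_C} C′` (fibre product of `Q → C → C/Γ_C` and `C′ → C → C/Γ_C`).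
[cite: MochizukiSemiAnbd2006, Thm A.4 proof p.84] -/
@[reducible] noncomputable def pbAmb : BTemp G :=
  pullbackObj (f.hom ≫ C.orbitQuotientπ) (d.hom.hom ≫ C.orbitQuotientπ)

/-- A base point `q₀ ∈ Q` (`Q` connected). [cite: MochizukiSemiAnbd2006, Thm A.4 proof p.84] -/
noncomputable def pbBase : Q.A.obj.V := (nonempty_of_isConnectedObj Q.A hQ).some

/-- A point `c′₀ ∈ C′` with `d c′₀ = f q₀` (`C′ → C` is onto). [cite: MochizukiSemiAnbd2006, Thm A.4 proof p.84] -/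
noncomputable def pbFibre : d.src.A.obj.V := (surjective_hom d (f.hom.hom.hom (pbBase hQ))).choose

/-- `d c′₀ = f q₀`. [cite: MochizukiSemiAnbd2006, Thm A.4 proof p.84] -/
theorem pbFibre_spec :
    (d.hom.hom.hom.hom (pbFibre d f hQ) : C.A.obj.V) = f.hom.hom.hom (pbBase hQ) :=
  (surjective_hom d (f.hom.hom.hom (pbBase hQ))).choose_spec

/-- The base point `z₀ = (q₀, c′₀)` of `Q ×_{C/Γ_C} C′`. [cite: MochizukiSemiAnbd2006, Thm A.4 proof p.84] -/
noncomputable def pbPt : (pbAmb d f).obj.V :=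
  pullbackPt _ _ (pbBase hQ) (pbFibre d f hQ) (by
    change C.orbitMk (f.hom.hom.hom (pbBase hQ)) = C.orbitMk (d.hom.hom.hom.hom (pbFibre d f hQ))
    rw [pbFibre_spec])

/-- `B″ :=` the `Π`-orbit of `z₀` (connected). [cite: MochizukiSemiAnbd2006, Thm A.4 proof p.84] -/
@[reducible] noncomputable def pbObj : BTemp G := orbitObj (pbAmb d f) (pbPt d f hQ)

/-- `B″` is connected. [cite: MochizukiSemiAnbd2006, Thm A.4 proof p.84] -/
theorem pbObj_isConnectedObj : IsConnectedObj (pbObj d f hQ) := orbitObj_isConnectedObj _ _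

/-- `Γ_B″ ≤ Aut(B″)`: the automorphisms of the orbit acting on the two coordinates by a pair
`(γ_Q, γ′) ∈ Γ_Q × Γ_C′`. [cite: MochizukiSemiAnbd2006, Thm A.4 proof p.84] -/
noncomputable def pbGroup : Subgroup (Aut (pbObj d f hQ)) where
  carrier := {τ | ∃ γQ ∈ Q.Γ, ∃ γ' ∈ d.src.Γ, ∀ y : (pbObj d f hQ).obj.V,
    ((τ.hom.hom.hom y : (pbObj d f hQ).obj.V).1).1 =
      ((γQ.hom.hom.hom y.1.1.1 : Q.A.obj.V), (γ'.hom.hom.hom y.1.1.2 : d.src.A.obj.V))}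
  one_mem' := ⟨1, Q.Γ.one_mem, 1, d.src.Γ.one_mem, fun _ => rfl⟩
  mul_mem' := by
    rintro τ τ' ⟨γQ, hγQ, γ', hγ', hτ⟩ ⟨δQ, hδQ, δ', hδ', hτ'⟩
    refine ⟨γQ * δQ, Q.Γ.mul_mem hγQ hδQ, γ' * δ', d.src.Γ.mul_mem hγ' hδ', fun y => ?_⟩
    change ((τ.hom.hom.hom (τ'.hom.hom.hom y) : (pbObj d f hQ).obj.V).1).1 =
      (γQ.hom.hom.hom (δQ.hom.hom.hom y.1.1.1), γ'.hom.hom.hom (δ'.hom.hom.hom y.1.1.2))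
    rw [hτ, hτ']
  inv_mem' := by
    rintro τ ⟨γQ, hγQ, γ', hγ', hτ⟩
    refine ⟨γQ⁻¹, Q.Γ.inv_mem hγQ, γ'⁻¹, d.src.Γ.inv_mem hγ', fun y => ?_⟩
    have h := hτ ((τ⁻¹).hom.hom.hom y)
    have hy : (τ.hom.hom.hom ((τ⁻¹).hom.hom.hom y) : (pbObj d f hQ).obj.V) = y := by
      change (((τ⁻¹).hom ≫ τ.hom).hom.hom y : (pbObj d f hQ).obj.V) = y
      rw [show (τ⁻¹).hom ≫ τ.hom = 𝟙 (pbObj d f hQ) from τ.inv_hom_id]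
      rfl
    rw [hy] at h
    have h1 := congrArg Prod.fst h
    have h2 := congrArg Prod.snd h
    simp only at h1 h2
    refine Prod.ext ?_ ?_
    · change (((τ⁻¹).hom.hom.hom y : (pbObj d f hQ).obj.V).1).1.1 = (γQ⁻¹).hom.hom.hom y.1.1.1
      rw [h1, aut_inv_apply_aut]
    · change (((τ⁻¹).hom.hom.hom y : (pbObj d f hQ).obj.V).1).1.2 = (γ'⁻¹).hom.hom.hom y.1.1.2
      rw [h2, aut_inv_apply_aut]

/-- Membership in `Γ_B″`. [cite: MochizukiSemiAnbd2006, Thm A.4 proof p.84] -/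
theorem mem_pbGroup_iff (τ : Aut (pbObj d f hQ)) :
    τ ∈ pbGroup d f hQ ↔ ∃ γQ ∈ Q.Γ, ∃ γ' ∈ d.src.Γ, ∀ y : (pbObj d f hQ).obj.V,
      ((τ.hom.hom.hom y : (pbObj d f hQ).obj.V).1).1 =
        ((γQ.hom.hom.hom y.1.1.1 : Q.A.obj.V), (γ'.hom.hom.hom y.1.1.2 : d.src.A.obj.V)) :=
  Iff.rfl

/-- The QD-pair `(B″, Γ_B″)`. [cite: MochizukiSemiAnbd2006, Thm A.4 proof p.84] -/
@[reducible] noncomputable def pbPair : QDPair (BTemp G) := ⟨pbObj d f hQ, pbGroup d f hQ⟩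

/-- The first projection `(B″, Γ_B″) → (Q, Γ_Q)` (`(γ_Q, γ′) ↦ γ_Q`).
[cite: MochizukiSemiAnbd2006, Thm A.4 proof p.84] -/
noncomputable def pbFst : pbPair d f hQ ⟶ Q :=
  ⟨orbitIncl _ _ ≫ pullbackFst _ _, by
    rintro τ ⟨γQ, hγQ, γ', hγ', hτ⟩
    refine ⟨γQ, hγQ, hom_ext_apply fun y => ?_⟩
    exact ((congrArg Prod.fst (hτ y)).symm :
      (γQ.hom.hom.hom y.1.1.1 : Q.A.obj.V) = ((τ.hom.hom.hom y : (pbObj d f hQ).obj.V).1).1.1)⟩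

/-- The second projection `(B″, Γ_B″) → (C′, Γ_C′)` (`(γ_Q, γ′) ↦ γ′`).
[cite: MochizukiSemiAnbd2006, Thm A.4 proof p.84] -/
noncomputable def pbSnd : pbPair d f hQ ⟶ d.src :=
  ⟨orbitIncl _ _ ≫ pullbackSnd _ _, by
    rintro τ ⟨γQ, hγQ, γ', hγ', hτ⟩
    refine ⟨γ', hγ', hom_ext_apply fun y => ?_⟩
    exact ((congrArg Prod.snd (hτ y)).symm :
      (γ'.hom.hom.hom y.1.1.2 : d.src.A.obj.V) = ((τ.hom.hom.hom y : (pbObj d f hQ).obj.V).1).1.2)⟩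

/-- `pr₁` on points. [cite: MochizukiSemiAnbd2006, Thm A.4 proof p.84] -/
@[simp] theorem pbFst_apply (y : (pbObj d f hQ).obj.V) :
    ((pbFst d f hQ).hom.hom.hom y : Q.A.obj.V) = y.1.1.1 := rfl

/-- `pr₂` on points. [cite: MochizukiSemiAnbd2006, Thm A.4 proof p.84] -/
@[simp] theorem pbSnd_apply (y : (pbObj d f hQ).obj.V) :
    ((pbSnd d f hQ).hom.hom.hom y : d.src.A.obj.V) = y.1.1.2 := rfl

/-- Every point of `B″` is a translate of the base point. [cite: MochizukiSemiAnbd2006, Thm A.4 proof p.84] -/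
theorem eq_ρ_orbitPt (y : (pbObj d f hQ).obj.V) :
    ∃ a : G, y = (pbObj d f hQ).obj.ρ a (orbitPt _ (pbPt d f hQ)) := by
  obtain ⟨a, ha⟩ := y.2
  exact ⟨a, Subtype.ext ha.symm⟩

/-- **The square commutes**: `pr₂ ≫ (C′ → C) = pr₁ ≫ f` on `B″` (it does at `(q₀, c′₀)`, and `B″` is
one orbit). [cite: MochizukiSemiAnbd2006, Thm A.4 proof p.84] -/
theorem pbSnd_hom_comp : (pbSnd d f hQ).hom ≫ d.hom.hom = (pbFst d f hQ).hom ≫ f.hom := by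
  refine hom_eq_of_apply_eq (pbObj_isConnectedObj d f hQ) _ _ (orbitPt _ (pbPt d f hQ)) ?_
  change (d.hom.hom.hom.hom (pbFibre d f hQ) : C.A.obj.V) = f.hom.hom.hom (pbBase hQ)
  exact pbFibre_spec d f hQ

/-- The square as an equation of morphisms of QD-pairs. [cite: MochizukiSemiAnbd2006, Thm A.4 proof p.84] -/
theorem pbSnd_comp : pbSnd d f hQ ≫ d.hom = pbFst d f hQ ≫ f :=
  Hom.ext (pbSnd_hom_comp d f hQ)

/-! ### Elements of `Γ_B″` from pairs `(γ_Q, γ′)` moving the base point inside the orbit -/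

/-- **Pairs give elements of `Γ_B″`**: if `γ_Q ∈ Γ_Q` and `γ′ ∈ Γ_C′` move `q₀`, `c′₀` to `a·q₀`,
`a·c′₀` for one `a ∈ Π`, then `(γ_Q, γ′)` (an automorphism of `Q ×_{C/Γ_C} C′`, `BTemp.pullbackAut`)
stabilises the orbit `B″` and restricts to an element of `Γ_B″` acting as `(γ_Q, γ′)` and sending the
base point to `a·z₀`. [cite: MochizukiSemiAnbd2006, Thm A.4 proof p.84] -/
theorem exists_mem_pbGroup {γQ : Aut Q.A} (hγQ : γQ ∈ Q.Γ) {γ' : Aut d.src.A} (hγ' : γ' ∈ d.src.Γ)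
    {a : G} (hq : (γQ.hom.hom.hom (pbBase hQ) : Q.A.obj.V) = Q.A.obj.ρ a (pbBase hQ))
    (hc : (γ'.hom.hom.hom (pbFibre d f hQ) : d.src.A.obj.V) = d.src.A.obj.ρ a (pbFibre d f hQ)) :
    ∃ τ ∈ pbGroup d f hQ,
      (∀ y : (pbObj d f hQ).obj.V, ((τ.hom.hom.hom y : (pbObj d f hQ).obj.V).1).1 =
        ((γQ.hom.hom.hom y.1.1.1 : Q.A.obj.V), (γ'.hom.hom.hom y.1.1.2 : d.src.A.obj.V))) ∧
      (τ.hom.hom.hom (orbitPt _ (pbPt d f hQ)) : (pbObj d f hQ).obj.V) =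
        (pbObj d f hQ).obj.ρ a (orbitPt _ (pbPt d f hQ)) := by
  -- `γ_Q` and `γ′` lie over `C/Γ_C`
  have hσ : γQ.hom ≫ (f.hom ≫ C.orbitQuotientπ) = f.hom ≫ C.orbitQuotientπ := by
    obtain ⟨γC, hγC, hcomm⟩ := f.comm γQ hγQ
    rw [← Category.assoc, ← hcomm, Category.assoc, C.aut_comp_orbitQuotientπ hγC]
  have hτ : γ'.hom ≫ (d.hom.hom ≫ C.orbitQuotientπ) = d.hom.hom ≫ C.orbitQuotientπ := by
    obtain ⟨γC, hγC, hcomm⟩ := d.hom.comm γ' hγ'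
    rw [← Category.assoc, ← hcomm, Category.assoc, C.aut_comp_orbitQuotientπ hγC]
  let σ : Aut (pbAmb d f) := pullbackAut _ _ γQ γ' hσ hτ
  have hσz : (pbAmb d f).obj.ρ a (pbPt d f hQ) = σ.hom.hom.hom (pbPt d f hQ) :=
    pullbackObj_ext _ _ hq.symm hc.symm
  have hσmem : σ ∈ stabOrbit _ (pbPt d f hQ) := (mem_stabOrbit_iff _ _ σ).mpr ⟨a, hσz⟩
  refine ⟨restrictOrbit _ _ ⟨σ, hσmem⟩, ⟨γQ, hγQ, γ', hγ', fun y => rfl⟩, fun y => rfl, ?_⟩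
  exact Subtype.ext hσz.symm

/-- `k ∈ Ker(Γ_C′ → Γ_C)` with `k x = a·x` for some point: then `(1, k) ∈ Γ_B″`-shape data — the
special case `γ_Q = 1` of `exists_mem_pbGroup` needs `q₀ = a·q₀`; this version moves an ARBITRARY
orbit point `a·z₀` to `a′·z₀` when `a·q₀ = a′·q₀` and `k (a·c′₀) = a′·c′₀`.
[cite: MochizukiSemiAnbd2006, Thm A.4 proof p.84] -/
theorem exists_mem_pbGroup_of_fibre {k : Aut d.src.A} (hk : k ∈ d.src.Γ) {a a' : G}
    (hq : Q.A.obj.ρ a (pbBase hQ) = Q.A.obj.ρ a' (pbBase hQ))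
    (hc : (k.hom.hom.hom (d.src.A.obj.ρ a (pbFibre d f hQ)) : d.src.A.obj.V) =
      d.src.A.obj.ρ a' (pbFibre d f hQ)) :
    ∃ τ ∈ pbGroup d f hQ,
      (∀ y : (pbObj d f hQ).obj.V, ((τ.hom.hom.hom y : (pbObj d f hQ).obj.V).1).1 =
        ((y.1.1.1 : Q.A.obj.V), (k.hom.hom.hom y.1.1.2 : d.src.A.obj.V))) ∧
      (τ.hom.hom.hom ((pbObj d f hQ).obj.ρ a (orbitPt _ (pbPt d f hQ))) : (pbObj d f hQ).obj.V) =
        (pbObj d f hQ).obj.ρ a' (orbitPt _ (pbPt d f hQ)) := by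
  -- reduce to the base point with `a⁻¹ a′`
  have hq' : ((1 : Aut Q.A).hom.hom.hom (pbBase hQ) : Q.A.obj.V) = Q.A.obj.ρ (a⁻¹ * a') (pbBase hQ) := by
    change pbBase hQ = Q.A.obj.ρ (a⁻¹ * a') (pbBase hQ)
    rw [ρ_mul_apply, ← hq, ρ_inv_apply]
  have hc' : (k.hom.hom.hom (pbFibre d f hQ) : d.src.A.obj.V) =
      d.src.A.obj.ρ (a⁻¹ * a') (pbFibre d f hQ) := by
    have h := congrArg (d.src.A.obj.ρ a⁻¹) hc
    rw [← hom_ρ k.hom, ρ_inv_apply, ← ρ_mul_apply] at h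
    exact h
  obtain ⟨τ, hτmem, hτ, hτz⟩ := exists_mem_pbGroup d f hQ Q.Γ.one_mem hk hq' hc'
  refine ⟨τ, hτmem, fun y => (hτ y).trans rfl, ?_⟩
  rw [hom_ρ τ.hom, hτz, ← ρ_mul_apply, mul_inv_cancel_left]

/-! ### 1-properness of the first projection -/

/-- **`pr₁ : (B″, Γ_B″) → (Q, Γ_Q)` is 1-proper.** [cite: MochizukiSemiAnbd2006, Thm A.4 proof p.84] -/
theorem pbFst_isOneProper : Hom.IsOneProper (pbFst d f hQ) := by
  refine ⟨isZeroProper_of_isStronglyConnected _ ⟨orbitPt _ (pbPt d f hQ)⟩ hQ, ?_, ?_⟩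
  · -- LIFT
    intro γQ hγQ
    obtain ⟨γC, hγC, hfγ⟩ := f.comm γQ hγQ
    obtain ⟨γ', hγ', hdγ⟩ := d.isOneProper.2.1 γC hγC
    obtain ⟨a, ha⟩ := exists_ρ_eq_of_isConnectedObj Q.A hQ (pbBase hQ) (γQ.hom.hom.hom (pbBase hQ))
    -- `γ′ c′₀` and `a·c′₀` lie over the same point `γ_C (f q₀) = f (a·q₀)` of `C`
    have hfib : (d.hom.hom.hom.hom (γ'.hom.hom.hom (pbFibre d f hQ)) : C.A.obj.V) =
        d.hom.hom.hom.hom (d.src.A.obj.ρ a (pbFibre d f hQ)) := by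
      have e₁ := congrArg (fun φ : d.src.A ⟶ C.A => (φ.hom.hom (pbFibre d f hQ) : C.A.obj.V)) hdγ
      have e₂ := congrArg (fun φ : Q.A ⟶ C.A => (φ.hom.hom (pbBase hQ) : C.A.obj.V)) hfγ
      change (γC.hom.hom.hom (d.hom.hom.hom.hom (pbFibre d f hQ)) : C.A.obj.V) =
        d.hom.hom.hom.hom (γ'.hom.hom.hom (pbFibre d f hQ)) at e₁
      change (γC.hom.hom.hom (f.hom.hom.hom (pbBase hQ)) : C.A.obj.V) =
        f.hom.hom.hom (γQ.hom.hom.hom (pbBase hQ)) at e₂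
      rw [← e₁, pbFibre_spec, e₂, ← ha, hom_ρ f.hom, hom_ρ d.hom.hom, pbFibre_spec]
    obtain ⟨k, hk, hkpt⟩ := exists_stabilizer_apply_eq_of_hom_eq d hfib
    obtain ⟨τ, hτmem, hτ, -⟩ := exists_mem_pbGroup d f hQ hγQ (d.src.Γ.mul_mem hk.1 hγ') (a := a)
      ha.symm (by exact hkpt)
    refine ⟨τ, hτmem, hom_ext_apply fun y => ?_⟩
    change (γQ.hom.hom.hom ((pbFst d f hQ).hom.hom.hom y) : Q.A.obj.V) =
      (pbFst d f hQ).hom.hom.hom (τ.hom.hom.hom y)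
    rw [pbFst_apply, pbFst_apply, hτ]
  · -- QUOTIENT of `(B″, Stab_{Γ_B″}(pr₁))`
    refine ((⟨(pbPair d f hQ).A, (pbFst d f hQ).stabilizer⟩ : QDPair (BTemp G)).isQuotient_iff_surjective
      (pbFst d f hQ).hom).mpr ⟨fun τ hτ => hτ.2, ?_, ?_⟩
    · intro q
      obtain ⟨a, ha⟩ := exists_ρ_eq_of_isConnectedObj Q.A hQ (pbBase hQ) q
      exact ⟨(pbObj d f hQ).obj.ρ a (orbitPt _ (pbPt d f hQ)), ha⟩
    · intro y y' hyy'
      obtain ⟨a, rfl⟩ := eq_ρ_orbitPt d f hQ y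
      obtain ⟨a', rfl⟩ := eq_ρ_orbitPt d f hQ y'
      change Q.A.obj.ρ a (pbBase hQ) = Q.A.obj.ρ a' (pbBase hQ) at hyy'
      -- the second coordinates lie in one fibre of `C′ → C`
      have hfib : (d.hom.hom.hom.hom (d.src.A.obj.ρ a (pbFibre d f hQ)) : C.A.obj.V) =
          d.hom.hom.hom.hom (d.src.A.obj.ρ a' (pbFibre d f hQ)) := by
        rw [hom_ρ d.hom.hom, hom_ρ d.hom.hom, pbFibre_spec, ← hom_ρ f.hom, ← hom_ρ f.hom, hyy']
      obtain ⟨k, hk, hkpt⟩ := exists_stabilizer_apply_eq_of_hom_eq d hfib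
      obtain ⟨τ, hτmem, hτ, hτy⟩ := exists_mem_pbGroup_of_fibre d f hQ hk.1 hyy' hkpt
      have hτp : τ.hom ≫ (pbFst d f hQ).hom = (pbFst d f hQ).hom := hom_ext_apply fun w => by
        change ((pbFst d f hQ).hom.hom.hom (τ.hom.hom.hom w) : Q.A.obj.V) = (pbFst d f hQ).hom.hom.hom w
        rw [pbFst_apply, pbFst_apply, hτ]
      exact ⟨τ, ⟨hτmem, hτp⟩, hτy⟩

/-! ### The pulled-back cover -/

/-- **The pullback of the 1-proper cover `(C′, Γ_C′) → (C, Γ_C)` along `f : (Q, Γ_Q) → (C, Γ_C)`**,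
a 1-proper cover of the (strongly connected) QD-pair `(Q, Γ_Q)`.
[cite: MochizukiSemiAnbd2006, Thm A.4 proof p.84] -/
noncomputable def pullbackAlong : OneProperCover Q where
  src := pbPair d f hQ
  hom := pbFst d f hQ
  isStronglyConnected := pbObj_isConnectedObj d f hQ
  isOneProper := pbFst_isOneProper d f hQ

/-- Its source is `(B″, Γ_B″)`. [cite: MochizukiSemiAnbd2006, Thm A.4 proof p.84] -/
@[simp] theorem pullbackAlong_src : (pullbackAlong d f hQ).src = pbPair d f hQ := rfl

/-- Its arrow is `pr₁`. [cite: MochizukiSemiAnbd2006, Thm A.4 proof p.84] -/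
@[simp] theorem pullbackAlong_hom : (pullbackAlong d f hQ).hom = pbFst d f hQ := rfl

/-- **The second projection `(B″, Γ_B″) → (C′, Γ_C′)` of the pulled-back cover.**
[cite: MochizukiSemiAnbd2006, Thm A.4 proof p.84] -/
noncomputable def pullbackAlongSnd : (pullbackAlong d f hQ).src ⟶ d.src := pbSnd d f hQ

/-- **The pullback square of QD-pairs commutes**: `pr₂ ≫ (C′ → C) = pr₁ ≫ f`.
[cite: MochizukiSemiAnbd2006, Thm A.4 proof p.84] -/
theorem pullbackAlong_w : pullbackAlongSnd d f hQ ≫ d.hom = (pullbackAlong d f hQ).hom ≫ f :=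
  pbSnd_comp d f hQ

end OneProperCover

end QDPair

end Literature.AnabelianGeometry.SemiGraphs
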